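import Summits.QuantumFields.YangMills.Theorems.BalabanUVNodesN16H7LooseOfThm1At
import Summits.QuantumFields.YangMills.Theorems.BalabanUVNodesN16H5OfLettersB9SrcAllTorusPinned
import HarnessLib

/-!
# Route «BalabanUVNodes», cluster K4 «SpineRates» — node N16 = NE3: PER FAMILY, N16's LETTERS ∕ END-REGIME PROVISO ∕ LEAF β-SLOT ∕ R-β NODE STATEMENT FROM
# [Balaban1985BackgroundPropagators]'s FOUR LETTERS AT THE PINNED ALL-TORUS MEMBERS (node N05's edge in the γ′ currency) — the CONST-PIN road (with `h7`) and the
# (β16) LOOSE road (with [Balaban1985Variational] Theorem 1 at the torus instances, NO `h7`)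

Cell `pub-ymgap`, width seat `pub-ymgap-dag-n16-w2` (g3; director-ym №197 ∕ HUMAN RULING D-0149), node N16.  `--kind proof --supports stmt-QuantumFields-20544 --as helper`
(K3⁷ `SpineGivenEndpointR13SepCoPH`).  `bears_on: R4∕N16 · edge N05 → N16 · edge N07 → N16`.

WHY.  K3⁷ v5 (plan g82, (t-N16)) pins the NE3 layer of a rate reading to letters `ℓ₃ : T4Family → NE3Letters₁₁` (dag-n16-e module 43 `N16PinnedConst` ∣ `N16PinnedLoose`) and its
producers `choose` PER FAMILY over module 35's `exists_letters_inEndRegimeH_leafSlotHolderAT_of_edges (hg) (h5) (h7)` (const road) resp. dag-n16-w1's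
`exists_letters_inEndRegimeH_leafSlotHolderAT_of_h5_thm1At` (loose road); in both `h5` is node N05's edge (Theorem 4 ∕ Proposition 3 bodies on the pinned `zdGF3 (M_N ℂ) F.L β len`
family with constants and window).  This seat's file 1 `…N16H5OfLettersB9SrcAllTorusPinned` (p601904) supplies THAT `h5` from [Balaban1985BackgroundPropagators]'s four letters
`SLet ∕ SLetUB ∕ SB9P ∕ SH59src` at the PINNED members only (node N05's knit-of-record currency D9b ∕ D9d; no Prop 5 ∕ 6 ∕ 7 ∕ Thm 8 ∕ Lemma 1 ∕ Thm 2 line).  THIS FILE is the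
per-family composition — reading-free, hence valid under K3⁷ v4, v5 and any later re-key — in the shapes the pin producers and THE END's consumers read.

WHAT THIS FILE PROVES (BY NAME; 0 `def`, 0 `sorry`; `(M_N ℂ, 4, F.L)`, `[NeZero N]`; the four letters are named binders under the lineage's `letI : CStarAlgebra (M_N ℂ) := {}`):
* §1 ★ `exists_letters_inEndRegimeH_leafSlotHolderAT_of_lettersB9Src` (R-β, CONST road: module 35 ∘ file 1) — `g > 0`, letters + constants ∕ guards + length-letter lines, `h7`
  ⟹ letters `ℓ` with THE END's rows, `InEndRegimeH`, `LeafSlotHolderAT · β` at RR-1's object; ★ `exists_letters_n16HolderAt_of_lettersB9Src` — through n16-e's closer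
  (`0 ≤ β ≤ 1`): dag-n16-c's node predicate `N16HolderAt (ne3OfRecord₁₁ F (ne3ConstLayerOfRecord₁₁ F N ℓ)) β` = N16's conjunct of `RatesHolderAt` at the const-pinned layer.
* §2 ★ `exists_letters_inEndRegimeH_leafSlotHolderAT_of_lettersB9Src_thm1At` ((β16) LOOSE road: dag-n16-w1 file 6 ∘ file 1) — letters etc. and leaf-06's Theorem-1 reading
  `G hGm hG C hM hT` VERBATIM dag-n16-w1's (NO `h7`) ⟹ the rows at the loose object of radius `ℓ.ε ∕ C.B₃`; ★ `exists_letters_n16HolderAt_looseSub_of_lettersB9Src_thm1At` — the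
  node predicate (+ rows, proviso, slot) at ANY letter-dependent sub-domain `D ℓ` of the loose ball (dag-n16-w1 v1.2 `…looseSub_of_h5_thm1At`; what module 43 v1.1 (iii) reads).
* §3 `guards_inhabited` — the constant guards are DIALS: for any letter constants `BG, BR ≥ 0`, `γ₈ ≥ 1`, `γ' ≥ 0` some `inp`, `B₈` meet them all (A6 hygiene).

HONEST FRAMING.  Compositions BY NAME; no estimate; the four letters (Thm 3.3-type statements at the no-holes members, `k ≥ 1`; inhabited in the tree at `m = 0` only — the N06
lineage's OPEN content, LOCATED), `h7` (node N07's) and `hT` ([Balaban1985Variational] Thm 1 at leaf-06's torus instances) are HYPOTHESES inhabited by nothing here; nothing of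
Bałaban asserted; `stub_h5` ∕ `stub_h7` NOT closed; **N16 ∕ N05 ∕ N06 ∕ N07 NOT discharged**; count-neutral (typed 28∕28 · discharged 5∕27 UNMOVED); one finite four-torus at
fixed ε — NOT ℝ⁴ ∕ OS ∕ mass gap; the YM mass gap (Clay) is NOT proved — R4 closes the conditional finite-𝕋⁴ rung `BalabanLadder.UV` only.  No `sorry` ∕ `def` ∕ `instance` ∕ `notation`.
-/

set_option autoImplicit false

open scoped BigOperators Matrix Matrix.Norms.L2Operator
open NormedSpace

noncomputable section

namespace Summit.QuantumFields.YangMills.BalabanUVNodes.N16LettersOfLettersB9SrcAllTorus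

open Literature.MathematicalPhysics.QuantumFieldTheory.Balaban1983to89
open Literature.MathematicalPhysics.QuantumFieldTheory.Balaban1983to89.T4Continuum (T4Family)
open B7Prop1Explicit B7Prop2Explicit MatrixLog UnitaryModel
open T4AveragingDeficitWall hiding Site Plane Plaq Bond
open Summit.QuantumFields.BalabanUV.T4Continuum
open B7Prop3Flat (c3) open B7Prop1Local (InBox)
open B8LeafModelZd (ZdIdx)
open B8LeafModelZd3 (zdGF3 SockB9P3)
open B8TowerBondsPrinted (towerBondsP)
open B8SockLettersRD (SockLettersRD)
open B8Lemma1NonAbelian (mulCfg)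
open B8LanF146 (LanF146)
open B8Eq138LandauZd (covLap QT InR138)
open B7Eq92Concrete (mgauge)
open B8Ineq130 (tlo thi) open B8Ineq132 (InAk covDerivFwd) open B7Eq78Linearization (zdBlocking QprimeIter)
open B8Eq119TwistedAxial (bgT Restr129 InAx) open B8Eq140Level (SideTouches) open B8Eq1117Concrete (XSpace) open B8Prop5ContractionKLevel (Bd2)
open B8LambdaSpaceKLevel (wt) open B8Eq184Proof (cfgExp) open B8Eq146AExpansion (iEta) open B7Prop4GeneralLevels (linCovIter)
open B8Eq155JBound (Jcur wsup) open B8ScaledSupNorm (bondNorm msup Bdd)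
open Node00 (NE3Letters₁₁ ne3ConstLayerOfRecord₁₁ ne3NperOfRecord₁₁ ne3DomOfRecord₁₁ MatA)
open NE3.LeafIndexSockets (LeafH3sup)
open MinimalActionRate (sfClass)
open MinimalActionDictionary (torusVP RadiiMono)
open AveragingDeficitLatticeH2Prep (fd)
open B11Thm1 (Thm1At)
open YMDAG.UVSplit (ne3OfRecord₁₁)
open Summit.QuantumFields.YangMills.BalabanUVNodes.N16HolderDefs (N16HolderAt)
open Summit.QuantumFields.YangMills.BalabanUVNodes.N16HolderRegime (InEndRegimeH radiusOfRecordH constOfRecordH)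
open Summit.QuantumFields.YangMills.BalabanUVNodes.N16LeafSlotAllTorus (LeafSlotHolderAT n16HolderAt_of_inEndRegimeH_leafSlotHolderAT)
open Summit.QuantumFields.YangMills.BalabanUVNodes.N16LettersOfEdgesAllTorus (exists_letters_inEndRegimeH_leafSlotHolderAT_of_edges)
open Summit.QuantumFields.YangMills.BalabanUVNodes.N16H7LooseOfThm1At (exists_letters_inEndRegimeH_leafSlotHolderAT_of_h5_thm1At
  exists_letters_n16HolderAt_looseSub_of_h5_thm1At)
open Summit.QuantumFields.YangMills.BalabanUVNodes.N16H5OfLettersB9SrcAllTorusPinned (h5_of_lettersB9Src_allTorusPinned)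

variable {N : ℕ} [NeZero N]

section PerFamily

/-! ### Shared hypotheses of §1–§2 (section variables, included in every theorem below, in this order): the family `F`, a coupling letter `g > 0`, the exponent `β` and
length letter `len` with N16's two lines, the input record `inp`, `C₂`, `B₀(β₀)`, the constants under node N05's D9b guards, and [Balaban1985BackgroundPropagators]'s FOUR
LETTERS `SLet ∕ SLetUB ∕ SB9P ∕ SH59src` AT THE PINNED ALL-TORUS MEMBERS of `(M_N ℂ, 4, F.L)` ONLY (file 1's binders at `L := F.L`, each under the lineage's `letI`) -/

variable (F : T4Family) {g : ℝ} (hg : 0 < g) (β : ℝ) {len : Site 4 → ℝ}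
    (hlen : ∀ v : Site 4, 0 < len v → 1 ≤ len v) (hlen1 : ∀ μ : Fin 4, len (e μ) = 1)
    (inp : B8.B9Inputs) {B₀β C₂ : ℝ} (hB₀β : 0 ≤ B₀β) (hC₂eq : C₂ = 2097152 * (((4 : ℕ) : ℝ) + 1) ^ 2 * (F.L : ℝ) ^ 2)
    {cB9 B₀'H B₂' BG BR cL c59 γ₈ γ' B₈ : ℝ}
    (hcB9 : 0 < cB9) (hB₀'H : 0 < B₀'H) (hB₂' : 0 ≤ B₂') (hBG : 0 ≤ BG) (hBR : 0 ≤ BR) (hcL : 0 < cL) (hc59 : 0 < c59) (hγ₈ : 1 ≤ γ₈) (hγ' : 0 ≤ γ')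
    (hB : 2 ≤ 5 * ((4 : ℕ) : ℝ) * F.L * inp.B₀) (hB₀8 : inp.B₀ ≤ B₈)
    (hγB : 5 * ((4 : ℕ) : ℝ) * F.L * inp.B₀ + 2 * (γ' * inp.B₀) ≤ 5 * ((4 : ℕ) : ℝ) * F.L * B₈)
    (hfreeS : 3 * (2 * ((4 : ℕ) : ℝ) * (F.L : ℝ) ^ 2) * BG * BR * (B₈ + γ₈) ≤ inp.B₀' * B₈)
    (SLet : letI : CStarAlgebra (Matrix (Fin N) (Fin N) ℂ) := {}
      ∀ i : {i : ZdIdx 4 F.L // (∀ j, i.Ω j = Set.univ) ∧ (∀ m j, i.Λs m j = {_y | j = m}) ∧ (∀ m j, i.Λb m j = {_c | j = m}) ∧ i.η = ((F.L : ℝ)⁻¹) ^ i.k},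
      SockLettersRD (𝔸 := Matrix (Fin N) (Fin N) ℂ) F.L BG BR B₀'H B₂' cL i.1.η i.1.k i.1.Ω i.1.Λs)
    (SLetUB : letI : CStarAlgebra (Matrix (Fin N) (Fin N) ℂ) := {}
      ∀ i : {i : ZdIdx 4 F.L // (∀ j, i.Ω j = Set.univ) ∧ (∀ m j, i.Λs m j = {_y | j = m}) ∧ (∀ m j, i.Λb m j = {_c | j = m}) ∧ i.η = ((F.L : ℝ)⁻¹) ^ i.k},
      ∀ α₀ : ℝ, 0 < α₀ → α₀ ≤ cL → ∀ U₀ : Site 4 → Fin 4 → (Matrix (Fin N) (Fin N) ℂ)ˣ, (∀ x κ, U₀ x κ ∈ unitaryUnits (Matrix (Fin N) (Fin N) ℂ)) →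
      InAk F.L i.1.k i.1.η α₀ i.1.Ω U₀ →
      ∃ (g Δ : (Site 4 → Matrix (Fin N) (Fin N) ℂ) →ₗ[ℂ] (Site 4 → Matrix (Fin N) (Fin N) ℂ)) (q : (Site 4 → Matrix (Fin N) (Fin N) ℂ) →ₗ[ℂ] (ℕ → Site 4 → Matrix (Fin N) (Fin N) ℂ))
        (qs : (ℕ → Site 4 → Matrix (Fin N) (Fin N) ℂ) →ₗ[ℂ] (Site 4 → Matrix (Fin N) (Fin N) ℂ)) (Aw c : (ℕ → Site 4 → Matrix (Fin N) (Fin N) ℂ) →ₗ[ℂ] (ℕ → Site 4 → Matrix (Fin N) (Fin N) ℂ))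
        (H' : XSpace 4 i.1.k (Matrix (Fin N) (Fin N) ℂ) →ₗ[ℂ] (Site 4 → Matrix (Fin N) (Fin N) ℂ)),
        (∀ x : Site 4 → Matrix (Fin N) (Fin N) ℂ, (∃ C : ℝ, ∀ y, ‖x y‖ ≤ C) → g (Δ x + qs (Aw (q x))) = x) ∧ (∀ φ, qs (c (q (g (g (qs φ))))) = qs φ) ∧
        (∀ (f : Site 4 → Matrix (Fin N) (Fin N) ℂ), ∀ x ∈ i.1.Ω 0, Δ f x = covLap i.1.η U₀ ((i.1.Ω 0).indicator f) x) ∧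
        (∀ (μ : ℕ → Site 4 → Matrix (Fin N) (Fin N) ℂ), ∀ x ∈ i.1.Ω 0, qs μ x = QT F.L i.1.k (i.1.Λs i.1.k) U₀ μ x) ∧
        (∀ (f : Site 4 → Matrix (Fin N) (Fin N) ℂ) (n : ℕ), n ≤ i.1.k → ∀ y ∈ i.1.Λs i.1.k n, q f n y = QprimeIter (zdBlocking 4 F.L) (bgT F.L U₀) n f y) ∧
        (∀ (f : Site 4 → Matrix (Fin N) (Fin N) ℂ) (n : ℕ) (y : Site 4), ¬ (n ≤ i.1.k ∧ y ∈ i.1.Λs i.1.k n) → q f n y = 0) ∧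
        (∀ (X : XSpace 4 i.1.k (Matrix (Fin N) (Fin N) ℂ)) (x : Site 4), ‖H' X x‖ ≤ B₀'H * ‖X‖) ∧
        (∀ n, n ≤ i.1.k → ∀ (X : XSpace 4 i.1.k (Matrix (Fin N) (Fin N) ℂ)), ∀ p ∈ {b : Site 4 × Fin 4 | SideTouches (i.1.Ω n) b.1 b.2},
          wt F.L i.1.η n * ‖covDerivFwd i.1.η U₀ p.2 (H' X) p.1‖ ≤ B₀'H * ‖X‖) ∧
        (∀ X : XSpace 4 i.1.k (Matrix (Fin N) (Fin N) ℂ), Bd2 F.L i.1.η i.1.k i.1.Ω (covLap i.1.η U₀ (H' X)) (B₂' * ‖X‖)) ∧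
        (∀ (Y : XSpace 4 i.1.k (Matrix (Fin N) (Fin N) ℂ)) (n : ℕ) (hn : n ≤ i.1.k) (y : Site 4), y ∈ i.1.Λs i.1.k n →
          QprimeIter (zdBlocking 4 F.L) (bgT F.L U₀) n (H' Y) y = Y (⟨n, Nat.lt_succ_of_le hn⟩, y)) ∧
        (∀ (f : Site 4 → Matrix (Fin N) (Fin N) ℂ) (r : ℝ), 0 ≤ r → Bd2 F.L i.1.η i.1.k i.1.Ω f r →
          (∀ x, ‖g f x‖ ≤ BG * r) ∧ ∀ n, n ≤ i.1.k → ∀ p ∈ {b : Site 4 × Fin 4 | SideTouches (i.1.Ω n) b.1 b.2},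
            wt F.L i.1.η n * ‖covDerivFwd i.1.η U₀ p.2 (g f) p.1‖ ≤ BG * r) ∧
        (∀ (f : Site 4 → Matrix (Fin N) (Fin N) ℂ) (r : ℝ), 0 ≤ r → Bd2 F.L i.1.η i.1.k i.1.Ω f r → Bd2 F.L i.1.η i.1.k i.1.Ω (f - g (qs (c (q (g f))))) (BR * r)))
    (SB9P : letI : CStarAlgebra (Matrix (Fin N) (Fin N) ℂ) := {}
      ∀ i : {i : ZdIdx 4 F.L // (∀ j, i.Ω j = Set.univ) ∧ (∀ m j, i.Λs m j = {_y | j = m}) ∧ (∀ m j, i.Λb m j = {_c | j = m}) ∧ i.η = ((F.L : ℝ)⁻¹) ^ i.k},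
      SockB9P3 (𝔸 := Matrix (Fin N) (Fin N) ℂ) F.L inp.B₀ B₀β cB9 β len i.1.η i.1.k i.1.Ω i.1.Λs (fun m j => towerBondsP F.L i.1.Ω (i.1.Λs m) j))
    (SH59src : letI : CStarAlgebra (Matrix (Fin N) (Fin N) ℂ) := {}
      ∀ i : {i : ZdIdx 4 F.L // (∀ j, i.Ω j = Set.univ) ∧ (∀ m j, i.Λs m j = {_y | j = m}) ∧ (∀ m j, i.Λb m j = {_c | j = m}) ∧ i.η = ((F.L : ℝ)⁻¹) ^ i.k},
      ∀ α₀ α₁ : ℝ, 0 < α₀ → 0 < α₁ → α₀ + α₁ ≤ c59 →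
      ∀ U₀ U' : Site 4 → Fin 4 → (Matrix (Fin N) (Fin N) ℂ)ˣ, (∀ x κ, U₀ x κ ∈ unitaryUnits (Matrix (Fin N) (Fin N) ℂ)) → (∀ x κ, U' x κ ∈ unitaryUnits (Matrix (Fin N) (Fin N) ℂ)) →
      ∀ φ : Site 4 → Matrix (Fin N) (Fin N) ℂ, ((InR138 F.L i.1.k i.1.η (i.1.Ω 0) (i.1.Λs i.1.k) U₀ φ ∧ (∀ x, IsSelfAdjoint (φ x)) ∧ (∀ x, x ∉ i.1.Ω 0 → φ x = 0) ∧
          Bdd F.L i.1.k i.1.η (-(2 : ℝ)) (fun j (x : Site 4) => x ∈ i.1.Ω j) φ) ∧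
        msup F.L i.1.k i.1.η (-(2 : ℝ)) (fun j (x : Site 4) => x ∈ i.1.Ω j) φ < γ₈ * (α₀ + α₁)) →
      InAk F.L i.1.k i.1.η α₀ i.1.Ω U₀ → InAk F.L i.1.k i.1.η α₀ i.1.Ω (mulCfg U' U₀) → (∀ m, m ≤ i.1.k → InAx F.L m (i.1.Λs m) U₀ (mulCfg U' U₀)) →
      (∀ j, j ≤ i.1.k → ∀ (z : Site 4) (μ : Fin 4),
        ((∀ x, InBox (tlo F.L z j) (thi F.L z j) x → x ∈ i.1.Ω j) ∨ (∀ x, InBox (tlo F.L (z + e μ) j) (thi F.L (z + e μ) j) x → x ∈ i.1.Ω j)) →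
        ‖(avgIter F.L (mulCfg U' U₀) j z μ : Matrix (Fin N) (Fin N) ℂ) - (avgIter F.L U₀ j z μ : Matrix (Fin N) (Fin N) ℂ)‖ ≤ α₁) →
      (∀ b ∈ {b : Site 4 × Fin 4 | SideTouches (i.1.Ω 0) b.1 b.2}, ‖((U' b.1 b.2 : (Matrix (Fin N) (Fin N) ℂ)ˣ) : Matrix (Fin N) (Fin N) ℂ) - 1‖ ≤ α₁) →
      (∀ m, 1 ≤ m → m ≤ i.1.k → ∀ (u : Site 4 → (Matrix (Fin N) (Fin N) ℂ)ˣ) (W : Site 4 → Fin 4 → (Matrix (Fin N) (Fin N) ℂ)ˣ) (A' : Site 4 → Fin 4 → Matrix (Fin N) (Fin N) ℂ),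
        (∀ x, u x ∈ unitaryUnits (Matrix (Fin N) (Fin N) ℂ)) → mgauge U₀ u W = U' → Restr129 F.L m (i.1.Λs m) U₀ u → LanF146 F.L i.1.k i.1.η (i.1.Ω 0) i.1.Λs U₀ φ m W →
        (∀ y τ, IsSelfAdjoint (A' y τ)) →
        (∀ j, j ≤ m → ∀ y τ, SideTouches (i.1.Ω j) y τ →
        W y τ = cfgExp i.1.η A' y τ ∧ ‖A' y τ‖ ≤ (2 * (F.L * (5 * ((4 : ℕ) : ℝ) * F.L * B₈ * (α₀ + α₁))) + 8 * (8 * inp.B₀' * (5 * ((4 : ℕ) : ℝ) * F.L * B₈) * (α₀ + α₁))) * ((F.L : ℝ) ^ j * i.1.η)⁻¹) →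
        (∀ y τ, (∀ j, j ≤ m → ¬ SideTouches (i.1.Ω j) y τ) → A' y τ = 0) →
        msup F.L m i.1.η (-(1 : ℝ)) (fun j (b : Site 4 × Fin 4) => SideTouches (i.1.Ω j) b.1 b.2) (fun b => A' b.1 b.2)
        ≤ inp.B₀ * (bondNorm F.L m i.1.η (-(3 : ℝ)) i.1.Ω (fun x μ => Jcur i.1.η U₀ A' μ x)
        + wsup 1 (fun p : {p : ℕ × (Site 4 × Fin 4) // p.1 ≤ m ∧ p.2 ∈ towerBondsP F.L i.1.Ω (i.1.Λs m) p.1} =>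
        linCovIter F.L U₀ (iEta i.1.η A') p.1.1 p.1.2.1 p.1.2.2)) + γ' * inp.B₀ * (α₀ + α₁) ∧
        msup F.L m i.1.η (-(2 : ℝ)) (fun j (t : Fin 4 × Fin 4 × Site 4) => SideTouches (i.1.Ω j) t.2.2 t.2.1)
        (fun t => covDerivFwd i.1.η U₀ t.1 (fun z => A' z t.2.1) t.2.2)
        ≤ inp.B₀ * (bondNorm F.L m i.1.η (-(3 : ℝ)) i.1.Ω (fun x μ => Jcur i.1.η U₀ A' μ x)
        + wsup 1 (fun p : {p : ℕ × (Site 4 × Fin 4) // p.1 ≤ m ∧ p.2 ∈ towerBondsP F.L i.1.Ω (i.1.Λs m) p.1} =>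
        linCovIter F.L U₀ (iEta i.1.η A') p.1.1 p.1.2.1 p.1.2.2)) + γ' * inp.B₀ * (α₀ + α₁)))

include hg hlen hlen1 hB₀β hC₂eq hcB9 hB₀'H hB₂' hBG hBR hcL hc59 hγ₈ hγ' hB hB₀8 hγB hfreeS SLet SLetUB SB9P SH59src

/-! ## §1 ★ The CONST-PIN road (R-β): letters ∕ `InEndRegimeH` ∕ `LeafSlotHolderAT · β` ∕ `N16HolderAt · β` at RR-1's object, from the four letters and `h7` -/

/-- ★ **PER FAMILY, R-β, CONST ROAD: N16's LETTERS WITH THE β-UNIFORM PROVISO, THE LEAF β-SLOT AND N21's NUMERALS FROM [Balaban1985BackgroundPropagators]'s FOUR LETTERS AT THE PINNED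
MEMBERS AND NODE N07's LINEAR LEAF** — hypotheses: a coupling letter `g > 0`; exponent `β` and length letter `len` with N16's two lines; the input record `inp`, `C₂ = 2²¹·5²·F.L²`,
`0 ≤ B₀(β₀)`, constants `cB9 B₀'H B₂' BG BR cL c59 γ₈ γ' B₈` under node N05's D9b guards; the four letters at the PINNED all-torus members of `(M_N ℂ, 4, F.L)` ONLY
(file 1's binders at `L := F.L`); `h7` = node N07's linear leaf (37ᴴ's).  Conclusion = module 35's VERBATIM; proof = module 35 with `h5 := h5_of_lettersB9Src_allTorusPinned …`.
Nothing of Bałaban is proved (letters = N06's open content at `m ≥ 1`, `h7` = N07's). [cite: Balaban1985RegularSpaces, Thm 4 p.88, Prop. 3 p.87, Thm 8 (1.146) p.101, p.77; Balaban1985BackgroundPropagators, Thm 3.3 p.398; Balaban1985Variational, Thm 1 (8)–(10) p.279] [folklore] -/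
theorem exists_letters_inEndRegimeH_leafSlotHolderAT_of_lettersB9Src
    (h7 : ∃ C ε₀ : ℝ, 0 ≤ C ∧ 0 < ε₀ ∧ ∀ ε : ℝ, 0 < ε → ε ≤ ε₀ →
      LeafH3sup 4 F.L (ne3NperOfRecord₁₁ F 0 0) ε (C * ε) (C * ε) (ne3DomOfRecord₁₁ F N 0 0)) :
    ∃ ℓ : NE3Letters₁₁, ℓ.g = g ∧ ℓ.Λ₁ = radiusOfRecordH N F.L (ne3NperOfRecord₁₁ F 0 0) ∧ ℓ.C = constOfRecordH N F.L (ne3NperOfRecord₁₁ F 0 0) g ∧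
      0 < ℓ.b ∧ 512 * (4 + 1) * (4 + 4) * (F.L : ℝ) ^ 2 * ℓ.b ≤ 1 ∧ 0 < ℓ.Λ₂' ∧
      InEndRegimeH (ne3OfRecord₁₁ F (ne3ConstLayerOfRecord₁₁ F N ℓ)) ∧ LeafSlotHolderAT (ne3OfRecord₁₁ F (ne3ConstLayerOfRecord₁₁ F N ℓ)) β :=
  exists_letters_inEndRegimeH_leafSlotHolderAT_of_edges F hg
    (h5_of_lettersB9Src_allTorusPinned (N := N) F.hL.2 β hlen hlen1 inp hB₀β hC₂eq hcB9 hB₀'H hB₂' hBG hBR hcL hc59 hγ₈ hγ' hB hB₀8 hγB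
      hfreeS SLet SLetUB SB9P SH59src)
    h7

/-- ★ **PER FAMILY, R-β (`0 ≤ β ≤ 1`), CONST ROAD: dag-n16-c's NODE PREDICATE `N16HolderAt · β` — N16's conjunct of `RatesHolderAt` — AT THE CONST-PINNED NE3 LAYER
`ne3OfRecord₁₁ F (ne3ConstLayerOfRecord₁₁ F N ℓ)`, FROM THE FOUR LETTERS AND `h7`**, with THE END's letter rows (what module 43's `N16LettersEnd` displays, minus the
`InEndRegimeH` row which §1 carries): §1 pushed through n16-e's closer `n16HolderAt_of_inEndRegimeH_leafSlotHolderAT`.  Reading-free: under module 43's `N16PinnedConst 𝔯 ℓ₃`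
with `ℓ₃ F := ℓ` this IS the N16 conjunct of `stub_rates13H` at every tuple and run length of family `F`.  Nothing of Bałaban is proved.
[cite: Balaban1985RegularSpaces, Thm 4 p.88, Prop. 3 p.87, (1.36) p.82; Balaban1985BackgroundPropagators, Thm 3.3 p.398; Balaban1985Variational, Thm 1 p.279] [folklore] -/
theorem exists_letters_n16HolderAt_of_lettersB9Src (hβ0 : 0 ≤ β) (hβ1 : β ≤ 1)
    (h7 : ∃ C ε₀ : ℝ, 0 ≤ C ∧ 0 < ε₀ ∧ ∀ ε : ℝ, 0 < ε → ε ≤ ε₀ →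
      LeafH3sup 4 F.L (ne3NperOfRecord₁₁ F 0 0) ε (C * ε) (C * ε) (ne3DomOfRecord₁₁ F N 0 0)) :
    ∃ ℓ : NE3Letters₁₁, ℓ.g = g ∧ ℓ.Λ₁ = radiusOfRecordH N F.L (ne3NperOfRecord₁₁ F 0 0) ∧ ℓ.C = constOfRecordH N F.L (ne3NperOfRecord₁₁ F 0 0) g ∧
      0 < ℓ.b ∧ 512 * (4 + 1) * (4 + 4) * (F.L : ℝ) ^ 2 * ℓ.b ≤ 1 ∧ 0 < ℓ.Λ₂' ∧
      InEndRegimeH (ne3OfRecord₁₁ F (ne3ConstLayerOfRecord₁₁ F N ℓ)) ∧ N16HolderAt (ne3OfRecord₁₁ F (ne3ConstLayerOfRecord₁₁ F N ℓ)) β := by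
  obtain ⟨ℓ, hgℓ, hΛ₁, hCℓ, hb0, hnum, hΛ₂'0, hreg, hslot⟩ := exists_letters_inEndRegimeH_leafSlotHolderAT_of_lettersB9Src F hg β hlen hlen1 inp hB₀β hC₂eq
    hcB9 hB₀'H hB₂' hBG hBR hcL hc59 hγ₈ hγ' hB hB₀8 hγB hfreeS SLet SLetUB SB9P SH59src h7
  exact ⟨ℓ, hgℓ, hΛ₁, hCℓ, hb0, hnum, hΛ₂'0, hreg, n16HolderAt_of_inEndRegimeH_leafSlotHolderAT hreg hβ0 hβ1 hslot⟩

/-! ## §2 ★ The (β16) LOOSE road (R-β): the same rows at the loose object, from the four letters and Theorem 1 at the torus instances — NO `h7` -/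

/-- ★ **PER FAMILY, R-β, LOOSE ROAD: N16's LETTERS ∕ `InEndRegimeH` ∕ LEAF β-SLOT AT THE LOOSE-DATA OBJECT OF RADIUS `ℓ.ε ∕ C.B₃`, FROM THE FOUR LETTERS AND [Balaban1985Variational]
THEOREM 1 AT leaf-06's TORUS INSTANCES** — hypotheses: `g > 0`, `β`, `len` with N16's two lines, constants ∕ guards and the four letters as in §1; leaf-06's Theorem-1 reading
`G hGm hG C hM hT` VERBATIM dag-n16-w1's (a local-gauge shape monotone in its radii with the (9)_{β₀=1} interface binder, constants with `M(ε₁) ≥ 7∕2` on `(0, a₁]`,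
`Thm1At C (torusVP 4 F.L Nper G (k+1))` at every `k` — DISPLAYED, asserted for nothing).  Conclusion = dag-n16-w1's, VERBATIM.  Proof: dag-n16-w1 file 6
`exists_letters_inEndRegimeH_leafSlotHolderAT_of_h5_thm1At` with `h5 := h5_of_lettersB9Src_allTorusPinned …`.  This is the (C1)(i) ∕ (β16) road in the current N05 currency:
N16's K3⁷ conjunct under the loose pin costs the four letters (N06) and Theorem 1 (N07's leaf-06 instances), nothing print-stronger.
[cite: Balaban1985Variational, Thm 1 (8)–(10) p.279; Balaban1985RegularSpaces, Thm 4 p.88, Prop. 3 p.87; Balaban1985BackgroundPropagators, Thm 3.3 p.398] [folklore] -/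
theorem exists_letters_inEndRegimeH_leafSlotHolderAT_of_lettersB9Src_thm1At
    {G : (Site 4 → Fin 4 → (MatA N)ˣ) → Site 4 → ℕ → ℝ → ℝ → ℝ → Prop} (hGm : RadiiMono 4 G)
    (hG : ∀ (U : Site 4 → Fin 4 → (MatA N)ˣ) (x : Site 4) (K : ℕ) (α₀ α₁ α₂ : ℝ), 2 ≤ K → G U x K α₀ α₁ α₂ →
      ∃ (u : Site 4 → (MatA N)ˣ) (a : Site 4 → Fin 4 → MatA N),
        (∀ z, u z ∈ unitaryUnits (MatA N)) ∧
        (∀ (y : Site 4) (τ : Fin 4), l1 (y - x) ≤ 2 → ((gaugeAct u U y τ : (MatA N)ˣ) : MatA N) = exp (a y τ)) ∧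
        (∀ (y : Site 4) (τ : Fin 4), l1 (y - x) ≤ 2 → ‖a y τ‖ ≤ α₀) ∧
        (∀ (y : Site 4) (τ i : Fin 4), l1 (y - x) ≤ 1 → ‖fd i (fun z => a z τ) y‖ ≤ α₁) ∧
        (∀ (τ i l : Fin 4), ‖fd i (fd l (fun z => a z τ)) x‖ ≤ α₂))
    (C : B11Thm1.Consts) (hM : ∀ e : ℝ, 0 < e → e ≤ C.a₁ → 7 / 2 ≤ C.Mfun e)
    (hT : ∀ k : ℕ, Thm1At C (torusVP 4 F.L (ne3NperOfRecord₁₁ F 0 0) G (k + 1))) :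
    ∃ ℓ : NE3Letters₁₁, ℓ.g = g ∧ ℓ.Λ₁ = radiusOfRecordH N F.L (ne3NperOfRecord₁₁ F 0 0) ∧ ℓ.C = constOfRecordH N F.L (ne3NperOfRecord₁₁ F 0 0) g ∧
      0 < ℓ.b ∧ 512 * (4 + 1) * (4 + 4) * (F.L : ℝ) ^ 2 * ℓ.b ≤ 1 ∧ 0 < ℓ.Λ₂' ∧
      InEndRegimeH (ne3OfRecord₁₁ F
        { ne3ConstLayerOfRecord₁₁ F N ℓ with
          dom := {V | V ∈ ne3DomOfRecord₁₁ F N 0 0 ∧ V ∈ sfClass 4 F.L (ne3NperOfRecord₁₁ F 0 0) (ℓ.ε / C.B₃) 0} }) ∧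
      LeafSlotHolderAT (ne3OfRecord₁₁ F
        { ne3ConstLayerOfRecord₁₁ F N ℓ with
          dom := {V | V ∈ ne3DomOfRecord₁₁ F N 0 0 ∧ V ∈ sfClass 4 F.L (ne3NperOfRecord₁₁ F 0 0) (ℓ.ε / C.B₃) 0} }) β :=
  exists_letters_inEndRegimeH_leafSlotHolderAT_of_h5_thm1At F hg
    (h5_of_lettersB9Src_allTorusPinned (N := N) F.hL.2 β hlen hlen1 inp hB₀β hC₂eq hcB9 hB₀'H hB₂' hBG hBR hcL hc59 hγ₈ hγ' hB hB₀8 hγB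
      hfreeS SLet SLetUB SB9P SH59src)
    hGm hG C hM hT

/-- ★ **PER FAMILY, R-β (`0 ≤ β ≤ 1`), THE (β16) LOOSE-AT ROAD OF RECORD (plan g82 WORDS-2 l.28174): dag-n16-c's NODE PREDICATE `N16HolderAt · β` (with the letter rows,
`InEndRegimeH` and the leaf β-slot) AT ANY LETTER-DEPENDENT SUB-DOMAIN `D ℓ` OF THE LOOSE `(ℓ.ε ∕ C.B₃)`-BALL, FROM THE FOUR LETTERS AND THEOREM 1 AT THE TORUS INSTANCES** —
dag-n16-w1's v1.2 `exists_letters_n16HolderAt_looseSub_of_h5_thm1At` (p602214; `D`, `hD` VERBATIM: e.g. `D ℓ :=` the data of record in the `min (ℓ.ε ∕ C.B₃) ℓ.b`-ball, `hD` by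
`minBall_subset_loose_and_b`) with `h5 := h5_of_lettersB9Src_allTorusPinned …`.  This is what module 43 v1.1 (iii) `choose`s over, in the letters currency: under `N16PinnedLooseAt 𝔯 ℓ₃ ρ`
family `F`'s N16 conjunct at every tuple and run length costs [Balaban1985BackgroundPropagators]'s four letters at the pinned members (N06) and [Balaban1985Variational] Theorem 1 at
leaf-06's torus instances (N07) — nothing node-N05-internal, nothing print-stronger.  Nothing of Bałaban is proved. [cite: Balaban1985Variational, Thm 1 (8)–(10) p.279; Balaban1985RegularSpaces, Thm 4 p.88, Prop. 3 p.87; Balaban1985BackgroundPropagators, Thm 3.3 p.398] [folklore] -/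
theorem exists_letters_n16HolderAt_looseSub_of_lettersB9Src_thm1At (hβ0 : 0 ≤ β) (hβ1 : β ≤ 1)
    {G : (Site 4 → Fin 4 → (MatA N)ˣ) → Site 4 → ℕ → ℝ → ℝ → ℝ → Prop} (hGm : RadiiMono 4 G)
    (hG : ∀ (U : Site 4 → Fin 4 → (MatA N)ˣ) (x : Site 4) (K : ℕ) (α₀ α₁ α₂ : ℝ), 2 ≤ K → G U x K α₀ α₁ α₂ →
      ∃ (u : Site 4 → (MatA N)ˣ) (a : Site 4 → Fin 4 → MatA N),
        (∀ z, u z ∈ unitaryUnits (MatA N)) ∧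
        (∀ (y : Site 4) (τ : Fin 4), l1 (y - x) ≤ 2 → ((gaugeAct u U y τ : (MatA N)ˣ) : MatA N) = exp (a y τ)) ∧
        (∀ (y : Site 4) (τ : Fin 4), l1 (y - x) ≤ 2 → ‖a y τ‖ ≤ α₀) ∧
        (∀ (y : Site 4) (τ i : Fin 4), l1 (y - x) ≤ 1 → ‖fd i (fun z => a z τ) y‖ ≤ α₁) ∧
        (∀ (τ i l : Fin 4), ‖fd i (fd l (fun z => a z τ)) x‖ ≤ α₂))
    (C : B11Thm1.Consts) (hM : ∀ e : ℝ, 0 < e → e ≤ C.a₁ → 7 / 2 ≤ C.Mfun e)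
    (hT : ∀ k : ℕ, Thm1At C (torusVP 4 F.L (ne3NperOfRecord₁₁ F 0 0) G (k + 1)))
    (D : NE3Letters₁₁ → Set (Site 4 → Fin 4 → (MatA N)ˣ))
    (hD : ∀ ℓ : NE3Letters₁₁, D ℓ ⊆ {V | V ∈ ne3DomOfRecord₁₁ F N 0 0 ∧ V ∈ sfClass 4 F.L (ne3NperOfRecord₁₁ F 0 0) (ℓ.ε / C.B₃) 0}) :
    ∃ ℓ : NE3Letters₁₁, ℓ.g = g ∧ ℓ.Λ₁ = radiusOfRecordH N F.L (ne3NperOfRecord₁₁ F 0 0) ∧ ℓ.C = constOfRecordH N F.L (ne3NperOfRecord₁₁ F 0 0) g ∧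
      0 < ℓ.b ∧ 512 * (4 + 1) * (4 + 4) * (F.L : ℝ) ^ 2 * ℓ.b ≤ 1 ∧ 0 < ℓ.Λ₂' ∧
      InEndRegimeH (ne3OfRecord₁₁ F { ne3ConstLayerOfRecord₁₁ F N ℓ with dom := D ℓ }) ∧
      LeafSlotHolderAT (ne3OfRecord₁₁ F { ne3ConstLayerOfRecord₁₁ F N ℓ with dom := D ℓ }) β ∧
      N16HolderAt (ne3OfRecord₁₁ F { ne3ConstLayerOfRecord₁₁ F N ℓ with dom := D ℓ }) β :=
  exists_letters_n16HolderAt_looseSub_of_h5_thm1At F hβ0 hβ1 hg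
    (h5_of_lettersB9Src_allTorusPinned (N := N) F.hL.2 β hlen hlen1 inp hB₀β hC₂eq hcB9 hB₀'H hB₂' hBG hBR hcL hc59 hγ₈ hγ' hB hB₀8 hγB
      hfreeS SLet SLetUB SB9P SH59src)
    hGm hG C hM hT D hD

end PerFamily

/-! ## §3 The constant guards are DIALS (A6 hygiene): for ANY letter constants they are met by a choice of `inp`, `B₈` -/

section Guards

/-- **THE GUARDS OF §§1–2 ∕ FILE 1 NEVER OBSTRUCT A LETTERS SUPPLIER** (any `L ≥ 1`, any `BG, BR ≥ 0`, `γ₈ ≥ 1`, `γ' ≥ 0` — i.e. whatever constants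
[Balaban1985BackgroundPropagators]'s letters come with): there are an input record `inp` (here `B₀ := 1`, `B₀' := 48·L²·BG·BR + 1`) and a Theorem-8 constant
`B₈ := 1 + γ' + γ₈` meeting `2 ≤ 5·4·L·B₀`, `B₀ ≤ B₈`, `5·4·L·B₀ + 2γ'B₀ ≤ 5·4·L·B₈` and the sourced free-constant guard `3(2·4·L²)·BG·BR·(B₈+γ₈) ≤ B₀'·B₈`
(the remaining guards `C₂ = …`, `0 ≤ B₀(β₀)`, `0 < cB9, B₀'H, cL, c59`, `0 ≤ B₂'` are free-standing).  So the only content of the hypotheses of §§1–2 is the four letters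
themselves (at whatever `inp.B₀'` the supplier's `SH59src` tolerates — a larger `B₀'` weakens that letter's antecedent, compensated by its threshold `c59`).  Elementary
arithmetic; nothing of Bałaban. [folklore] -/
theorem guards_inhabited (L : ℕ) (hL : 1 ≤ L) {BG BR γ₈ γ' : ℝ} (hBG : 0 ≤ BG) (hBR : 0 ≤ BR) (hγ₈ : 1 ≤ γ₈) (hγ' : 0 ≤ γ') :
    ∃ (inp : B8.B9Inputs) (B₈ : ℝ), 2 ≤ 5 * ((4 : ℕ) : ℝ) * L * inp.B₀ ∧ inp.B₀ ≤ B₈ ∧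
      5 * ((4 : ℕ) : ℝ) * L * inp.B₀ + 2 * (γ' * inp.B₀) ≤ 5 * ((4 : ℕ) : ℝ) * L * B₈ ∧
      3 * (2 * ((4 : ℕ) : ℝ) * (L : ℝ) ^ 2) * BG * BR * (B₈ + γ₈) ≤ inp.B₀' * B₈ := by
  have hL1 : (1 : ℝ) ≤ L := by exact_mod_cast hL
  have hGR : 0 ≤ BG * BR := mul_nonneg hBG hBR
  have hL2 : 0 ≤ (L : ℝ) ^ 2 * (BG * BR) := mul_nonneg (by positivity) hGR
  refine ⟨⟨1, 48 * (L : ℝ) ^ 2 * (BG * BR) + 1, one_pos, by positivity⟩, 1 + γ' + γ₈, ?_, ?_, ?_, ?_⟩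
  · show (2 : ℝ) ≤ 5 * ((4 : ℕ) : ℝ) * L * 1
    norm_num; linarith
  · show (1 : ℝ) ≤ 1 + γ' + γ₈
    linarith
  · show 5 * ((4 : ℕ) : ℝ) * L * 1 + 2 * (γ' * 1) ≤ 5 * ((4 : ℕ) : ℝ) * L * (1 + γ' + γ₈)
    norm_num; nlinarith
  · show 3 * (2 * ((4 : ℕ) : ℝ) * (L : ℝ) ^ 2) * BG * BR * (1 + γ' + γ₈ + γ₈) ≤ (48 * (L : ℝ) ^ 2 * (BG * BR) + 1) * (1 + γ' + γ₈)
    norm_num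
    nlinarith [hL2, mul_nonneg hL2 hγ', mul_nonneg hL2 (zero_le_one.trans hγ₈)]

end Guards

end Summit.QuantumFields.YangMills.BalabanUVNodes.N16LettersOfLettersB9SrcAllTorus

end
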